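import Summits.BirchSwinnertonDyer.Rank1Residual.Partition.MainConjecturesEisensteinTwistCertificate
import HarnessLib

/-!
# Row C6 at ONE prime: Castella–Grossi–Skinner's Theorem D at `p` from Mazur's main conjecture AT `p`
# IN ANALYTIC RANK ZERO ONLY — the per-prime binder that isolates the `p = 3` debt of row D4

HONEST FRAMING (cell `bsd-litref`, run/shared/lean/pub/bsd-litref/; programme
`BSD-LIT2PART-PROGRAMME-v1.md` §T2d, verbatim): "no tranche here proves BSD; ARM L moves the LITERAL
column of an r ≤ 1 census into the kernel-proved-modulo-named-print column". `Proofs`-style Summits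
file: THEOREMS ONLY — no definition, no named fact, nothing asserted. Seat `bsd-litref-cgs25-pv`
(prover), written for the cell's D-audit of CGS25 Thm. D (reader 1, `cgs25/sheets/D-AUDIT-cgs25-r1.md`
cd6b303b333505a2): node X = CGS25 Thm. 4.1.1 ⇐ «[BSTW23, §5]» is PASS-in-cell at `p ≥ 5` and
**GAP(line) at `p = 3`** (KLZ17 §§7–12 «p ≥ 5»; BSTW Thm. 3.1 / Rem. 5.1 ⇐ [SV-S-Ohta], unposted),
with the recommendation (sheet §6 item 4) to isolate the `@3` debt «in ONE displayed binder» — Theorem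
A's conclusion at the single prime — and to re-derive Theorem D at that prime from it «by the §4.1/§4.2
frames ALREADY in the tree by name».

## What this file proves

For a FIXED prime `p > 2`, write `MC₀(p)` for the hypothesis

> for every globally minimal elliptic `V/ℚ` with `p` good, `V[p]` reducible, `a_p(V) ≢ 1 (mod p)` and
> `ord_{s=1} L(V,s) = 0`: `MazurMainConjecture V p`

(the cell's typed per-pair statement `Rank1ResidualX1Defs.MazurMainConjecture`, Néron normalisation —
binder for binder the conclusion of `CastellaGrossiSkinner2025.thmA_charIdeal_eq_padicLFunction`, cf.
`mazurMainConjecture_of_cgsThmA`). It is Theorem A (= Thm. 7.1.1) AT THE PRIME `p`, and ONLY for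
analytic rank `0`. Then, granted the PUBLISHED Beilinson–Flach-free facts of the tree:

* `RowC6.bsdp_rankZero_of_mazurMainConjectureAt` — `MC₀(p)` ⟹ `BSD(E,p)` for every row-C6 pair
  `(E, p)` with `ord_{s=1} L(E,s) = 0` (Greenberg Thm. 4.1 + Mazur–Swinnerton-Dyer + GZK: the tree's
  `RowC6.bsdp_rankZero_of_mazurMainConjecture`, restated with the per-prime binder for symmetry).
* `RowC6.bsdp_rankOne_of_display55_of_mazurMainConjectureAt` — `MC₀(p)` ⟹ `BSD(E,p)` for every row-C6
  pair with `ord_{s=1} L(E,s) = 1`: Hoffstein–Luo gives an admissible `K`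
  (`exists_admissibleField_of_rootNumber_eq_neg_one`), the twist `E^{(d_K)}` is a rank-ZERO row-C6 curve
  at the same `p` (`partner_good_red_not_anom`), `MC₀(p)` closes `BSD(E^K,p)`, and the equivalence
  `RowC6.bsdp_rankOne_iff_bsdp_twist_of_display55` (CGLS22 display (5.5), A157, + Gross–Zagier + Kolyvagin
  + GZK + modularity) transfers it to `E`. So THEOREM A IS NEEDED ONLY IN ANALYTIC RANK ZERO — the
  printed «applying our result in the rank `0` case to `E^K`», now with the rank-`0` case itself cut
  down to its main-conjecture input at the one prime.
* `RowC6.bsdp_of_display55_of_mazurMainConjectureAt` — both ranks: `MC₀(p)` ⟹ Thm. D at `p` on row C6.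
* Sanity (not restated — the gate's dedup rule): the PUBLISHED Theorem A (`hA`, A142) discharges
  `MC₀(p)` at every `p > 2` through `mazurMainConjecture_of_cgsThmA`, and the conclusion is then
  literally the landed `RowC6.bsdp_of_display55_of_cgsThmA` (MainConjecturesEisensteinTwistIdentity).

USE. At `p ∈ {5, 7, 13}` the binder `MC₀(p)` is Theorem A refereed in cell (sheet verdict PASS); at
`p = 3` it is EXACTLY the typed target the sheet asks the typer to post (`…thmA_atThree_OPEN`, claim-
tagged, not a Literature fact): feeding that `def` (or its rank-`0` half) to
`RowC6.bsdp_of_display55_of_mazurMainConjectureAt (p := 3)` is a one-line corollary, so the `@3`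
classes of row D4 hang on ONE displayed binder and the `p ≥ 5` classes stay on the published fact. Per
class, the same `@3` pairs have the certificate roads of `MainConjecturesEisensteinTwistCertificate`
(twist `#Ш_an` unit, 1 884 / 1 901 rank-one D4 classes certified by kit j256228/j256354) and of
`EisensteinGoodComplementSplit` (Wuthrich unit / Schneider).

References: [CastellaGrossiSkinner2025] Math. Ann. 393 (2025), Thm. D and its proof (§1.2), Theorem A
= Thm. 7.1.1, Thm. 4.1.1; [CastellaGrossiLeeSkinner2022] Invent. Math. 227 (2022), proof of Thm. 5.3.1
(5.5)–(5.7); [GreenbergLNM1716] Thm. 4.1; [HoffsteinLuo1997]; [GrossZagier1986] Thm. I.7.3;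
[Miller2011LMS] Def. 1.1; cell sheet `pub/bsd-litref/cgs25/sheets/D-AUDIT-cgs25-r1.md` §0, §5.4, §6.
-/

set_option autoImplicit false

noncomputable section

open scoped Classical

open WeierstrassCurve NumberField Literature.NumberTheory.EllipticCurves
  Literature.NumberTheory.EllipticCurves.ModularForms Literature.NumberTheory.QuadraticFields
  Literature.NumberTheory.EllipticCurves.Rank1Residual
  Literature.NumberTheory.EllipticCurves.CastellaGrossiLeeSkinner2022
  Summit.BirchSwinnertonDyer.BirchSwinnertonDyer.Theorems.Rank1ResidualX1Defs

namespace Summit.BirchSwinnertonDyer.Rank1Residual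

/-- **Row C6 ∩ {r = 0} at one prime from `MC₀(p)`** (the tree's
`RowC6.bsdp_rankZero_of_mazurMainConjecture` with the per-prime, rank-zero-only binder of this file):
for `W/ℚ` globally minimal elliptic, `p > 2` good, `E[p]` reducible, `a_p ≢ 1 (mod p)`,
`ord_{s=1} L(E,s) = 0`: `BSDp W p`, from Mazur's main conjecture at `(W, p)` (supplied by `hMC0`),
Greenberg 1999 Thm. 4.1 (`hGr`), modularity (`hmodP`) and GZK. [cite: GreenbergLNM1716, Thm. 4.1 (p. 102)]
[cite: CastellaGrossiSkinner2025, Thm. D (r = 0) and its proof (§1.2)] [cite: Miller2011LMS, Def. 1.1] -/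
theorem RowC6.bsdp_rankZero_of_mazurMainConjectureAt (hGr : greenberg_charValue_rankZero)
    (hmodP : nonempty_modularParametrizationData) (hGZK : rank_eq_analyticRank_of_analyticRank_le_one)
    (p : ℕ) [Fact p.Prime] (hp : 2 < p)
    (hMC0 : ∀ (V : WeierstrassCurve ℚ) [V.IsElliptic] [V.IsGloballyMinimal],
      Good V p → Red V p → ¬ Anom V p → V.analyticRank = 0 → MazurMainConjecture V p)
    (W : WeierstrassCurve ℚ) [W.IsElliptic] [W.IsGloballyMinimal]
    (hgood : Good W p) (hred : Red W p) (hna : ¬ Anom W p) (hr0 : W.analyticRank = 0) : BSDp W p :=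
  RowC6.bsdp_rankZero_of_mazurMainConjecture hGr hmodP hGZK ⟨hp, hred, hgood, hna⟩ hr0
    (hMC0 W hgood hred hna hr0)

/-- **Row C6 ∩ {r = 1} at one prime from `MC₀(p)` — Theorem A is needed ONLY for the rank-zero twist.**
For `W/ℚ` globally minimal elliptic, `p > 2` good, `E[p]` reducible, `a_p ≢ 1 (mod p)`,
`ord_{s=1} L(E,s) = 1`: `BSDp W p`, granted Mazur's main conjecture at `p` for every rank-ZERO row-C6
curve (`hMC0`) and the published facts CGLS22 display (5.5) (`h55`, A157), Greenberg Thm. 4.1 (`hGr`),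
modularity (`hmodP`, `hnf`), Hoffstein–Luo (`hHL`), Gross–Zagier over `ℚ` (`hGZQ`) and over `K` (`hGZ`),
Kolyvagin (`hKo`), GZK. Proof: `w(E) = −1`; Hoffstein–Luo gives an admissible `K` ((a)–(d),
`exists_admissibleField_of_rootNumber_eq_neg_one`); a globally minimal model `Wd` of `E^{(d_K)}`
exists (`exists_isGloballyMinimal_smul_eq_quadraticTwist`); `Wd` is good, Eisenstein, non-anomalous at
`p` (`partner_good_red_not_anom`) of analytic rank `0`, so `hMC0` and the rank-zero skeleton give
`BSDp Wd p`; the equivalence `RowC6.bsdp_rankOne_iff_bsdp_twist_of_display55` transfers it to `W`.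
[cite: CastellaGrossiSkinner2025, Thm. D (r = 1) and its proof (§1.2): "applying our result in the rank 0 case to E^K"]
[cite: CastellaGrossiLeeSkinner2022, proof of Thm. 5.3.1, (5.5)–(5.7)] [cite: HoffsteinLuo1997, Theorem (§1)]
[cite: GreenbergLNM1716, Thm. 4.1 (p. 102)] -/
theorem RowC6.bsdp_rankOne_of_display55_of_mazurMainConjectureAt (h55 : display55_sha_heegnerIndex)
    (hGr : greenberg_charValue_rankZero)
    (hmodP : nonempty_modularParametrizationData) (hnf : exists_isNewformOf)
    (hHL : HoffsteinLuo1997_exists_twist_L_one_ne_zero) (hGZQ : GrossZagier1986_thm_I_7_3)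
    (hGZ : ∀ (N : ℕ) [NeZero N] (W : WeierstrassCurve ℚ) (K : Type) [Field K] [NumberField K],
      gross_zagier N W K)
    (hKo : ∀ (N : ℕ) [NeZero N] (W : WeierstrassCurve ℚ) (K : Type) [Field K] [NumberField K],
      kolyvagin N W K)
    (hGZK : rank_eq_analyticRank_of_analyticRank_le_one)
    (p : ℕ) [Fact p.Prime] (hp : 2 < p)
    (hMC0 : ∀ (V : WeierstrassCurve ℚ) [V.IsElliptic] [V.IsGloballyMinimal],
      Good V p → Red V p → ¬ Anom V p → V.analyticRank = 0 → MazurMainConjecture V p)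
    (W : WeierstrassCurve ℚ) [W.IsElliptic] [W.IsGloballyMinimal]
    (hgood : Good W p) (hred : Red W p) (hna : ¬ Anom W p) (hr : W.analyticRank = 1) : BSDp W p := by
  have hmod : hasEntireLFunction_rat := hasEntireLFunction_rat_of_exists_isNewformOf hnf
  -- `w(E) = -1` from `ord_{s=1} L(E,s) = 1`
  have hw : W.rootNumber = -1 := by
    have h := even_analyticRank_iff_rootNumber_eq_one.rootNumber_eq_neg_one_pow (W := W)
      (even_analyticRank_iff_rootNumber_eq_one_of_exists_isNewformOf W hnf)
    rw [hr, pow_one] at h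
    exact h
  -- an admissible `K` (Hoffstein–Luo) and a globally minimal model of the twist
  obtain ⟨K, _, _, hK, hodd, hlt, hHN, hHp, hLK⟩ :=
    exists_admissibleField_of_rootNumber_eq_neg_one hnf hHL W hw p
  have hd0 : (NumberField.discr K : ℚ) ≠ 0 := by
    exact_mod_cast (show NumberField.discr K ≠ 0 by omega)
  obtain ⟨Wd, _, _, C, hC⟩ := exists_isGloballyMinimal_smul_eq_quadraticTwist W hd0
  -- the twist is a rank-zero row-C6 curve at `p`: the main conjecture at `p` closes it
  obtain ⟨hgood_d, hred_d, hna_d⟩ := partner_good_red_not_anom hp hgood hred hna K hK hodd hHp Wd ⟨C, hC⟩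
  have hrd : Wd.analyticRank = 0 := RowC6.analyticRank_twist_eq_zero hmod W K hLK Wd ⟨C, hC⟩
  have hBd : BSDp Wd p :=
    RowC6.bsdp_rankZero_of_mazurMainConjectureAt hGr hmodP hGZK p hp hMC0 Wd hgood_d hred_d hna_d hrd
  -- transfer along the twist identity
  exact (RowC6.bsdp_rankOne_iff_bsdp_twist_of_display55 h55 hmodP hnf hGZQ hGZ hKo hGZK W p hp hgood
    hred hna hr K hK hodd hlt hHN hHp hLK Wd ⟨C, hC⟩).2 hBd

/-- **Castella–Grossi–Skinner's Theorem D AT ONE PRIME, from Mazur's main conjecture at that prime in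
analytic rank zero only.** For a fixed `p > 2` and `MC₀(p)` as in the module docstring: every
`W/ℚ` globally minimal elliptic with `p` good, `E[p]` reducible, `a_p ≢ 1 (mod p)` and
`ord_{s=1} L(E,s) ≤ 1` satisfies `BSDp W p` (rank `0`: `RowC6.bsdp_rankZero_of_mazurMainConjectureAt`;
rank `1`: `RowC6.bsdp_rankOne_of_display55_of_mazurMainConjectureAt`). At `p = 3` the binder `hMC0` is
the cell's typed `@3` target (sheet §6 item 4); at `p ≥ 5` it is Theorem A refereed in cell.
[cite: CastellaGrossiSkinner2025, Thm. D and its proof (§1.2), Theorem A = Thm. 7.1.1]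
[cite: CastellaGrossiLeeSkinner2022, proof of Thm. 5.3.1, (5.5)–(5.7)] [cite: GreenbergLNM1716, Thm. 4.1 (p. 102)] -/
theorem RowC6.bsdp_of_display55_of_mazurMainConjectureAt (h55 : display55_sha_heegnerIndex)
    (hGr : greenberg_charValue_rankZero)
    (hmodP : nonempty_modularParametrizationData) (hnf : exists_isNewformOf)
    (hHL : HoffsteinLuo1997_exists_twist_L_one_ne_zero) (hGZQ : GrossZagier1986_thm_I_7_3)
    (hGZ : ∀ (N : ℕ) [NeZero N] (W : WeierstrassCurve ℚ) (K : Type) [Field K] [NumberField K],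
      gross_zagier N W K)
    (hKo : ∀ (N : ℕ) [NeZero N] (W : WeierstrassCurve ℚ) (K : Type) [Field K] [NumberField K],
      kolyvagin N W K)
    (hGZK : rank_eq_analyticRank_of_analyticRank_le_one)
    (p : ℕ) [Fact p.Prime] (hp : 2 < p)
    (hMC0 : ∀ (V : WeierstrassCurve ℚ) [V.IsElliptic] [V.IsGloballyMinimal],
      Good V p → Red V p → ¬ Anom V p → V.analyticRank = 0 → MazurMainConjecture V p)
    (W : WeierstrassCurve ℚ) [W.IsElliptic] [W.IsGloballyMinimal]
    (hgood : Good W p) (hred : Red W p) (hna : ¬ Anom W p) (hr : W.analyticRank ≤ 1) : BSDp W p := by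
  rcases Nat.le_one_iff_eq_zero_or_eq_one.mp hr with hr0 | hr1
  · exact RowC6.bsdp_rankZero_of_mazurMainConjectureAt hGr hmodP hGZK p hp hMC0 W hgood hred hna hr0
  · exact RowC6.bsdp_rankOne_of_display55_of_mazurMainConjectureAt h55 hGr hmodP hnf hHL hGZQ hGZ hKo
      hGZK p hp hMC0 W hgood hred hna hr1

end Summit.BirchSwinnertonDyer.Rank1Residual

end
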